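import Summits.AtomisticToContinuum.BoseEinsteinCondensation.Theses.BECRieszReverseHolder

/-!
# Route `BECRieszReverseHolder` — support item `PositivityTransfer` (stmt-AtomisticToContinuum-12846)

Closes stmt-AtomisticToContinuum-12846 (exact signature of
`Summit.AtomisticToContinuum.BoseEinsteinCondensation.Theses.BECRieszReverseHolder.PositivityTransfer`):
the fixed-`N` frame `GroundStateEnergyFinite`, `GroundStateRigidity`, `PositiveNearMinimiserExists`,
`OccupationStability` transfers the flat-mode occupation bound for NON-NEGATIVE near-minimisers
(`PositiveZeroMode`, constant `c`) to ALL near-minimisers (constant `c/4`), i.e. to X_B1, the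
hypothesis of the proved `AtomisticToContinuum.BECInfraredBound.bec_of_zeroMode`.

Proof (pure bookkeeping, as filed): `ρ₀ :=` the minimum of the three thresholds; for `ρ < ρ₀` take
`c` from `PositiveZeroMode` and output `c/4`; eventually in `N = n + 1` (intersection of the three
eventual ranges with `N ≥ 1`) put `η := c/4`, `δ := min (δ_rig η) δ_pos`. Given a `δ`-near-minimiser
`Ψ`, `E₀ ≠ ⊤` yields a positive `δ`-near-minimiser `Φ`; rigidity applied to the pair `(Φ, Ψ)` gives a
unit `c₁` with `∫ |Φ - c₁Ψ|² ≤ η`; positivity gives `ofReal (c N) ≤ occ Φ`; stability (for the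
normalised, measurable flat mode — `lintegral_constMode_sq`, `aestronglyMeasurable_constMode` of
`BECInfraredBoundAssembly.lean`) gives `√occ Φ ≤ √occ Ψ + √N √η`. With `t := √N √η` one has
`t + t ≤ √(cN) ≤ √occ Ψ + t`, hence `t ≤ √occ Ψ` and `t² = (c/4) N ≤ occ Ψ`
(`PositivityTransfer.mul_le_of_sqrt_le`, `ℝ≥0∞` rpow bookkeeping).
-/

noncomputable section

namespace Summit.AtomisticToContinuum.BoseEinsteinCondensation.Theorems

open MeasureTheory Filter
open scoped ENNReal NNReal
open Literature.MathematicalPhysics.QuantumManyBody.BoseGas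

namespace PositivityTransfer

/-- `ℝ≥0∞` square-root bookkeeping behind the positivity transfer: if `√A ≤ √B + √N·√D`,
`D ≤ a`, `4·a·N ≤ A` and `N, a` are finite, then `a·N ≤ B` (with `t := √N·√a`:
`t + t ≤ √A ≤ √B + t`, so `t ≤ √B` and `t² = a·N ≤ B`). [folklore] -/
theorem mul_le_of_sqrt_le {A B D N a : ℝ≥0∞} (hN : N ≠ ∞) (ha : a ≠ ∞)
    (hA : 4 * (a * N) ≤ A)
    (hst : A ^ (1 / 2 : ℝ) ≤ B ^ (1 / 2 : ℝ) + N ^ (1 / 2 : ℝ) * D ^ (1 / 2 : ℝ))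
    (hD : D ≤ a) : a * N ≤ B := by
  have hsq : ∀ x : ℝ≥0∞, (x ^ (1 / 2 : ℝ)) ^ (2 : ℝ) = x := fun x => by
    rw [← ENNReal.rpow_mul]
    norm_num
  set t : ℝ≥0∞ := N ^ (1 / 2 : ℝ) * a ^ (1 / 2 : ℝ) with ht_def
  have ht : t ≠ ∞ :=
    ENNReal.mul_ne_top (ENNReal.rpow_ne_top_of_nonneg (by norm_num) hN)
      (ENNReal.rpow_ne_top_of_nonneg (by norm_num) ha)
  have ht2 : t ^ (2 : ℝ) = a * N := by
    rw [ht_def, ENNReal.mul_rpow_of_nonneg _ _ (by norm_num : (0 : ℝ) ≤ 2), hsq, hsq, mul_comm]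
  have h1 : A ^ (1 / 2 : ℝ) ≤ B ^ (1 / 2 : ℝ) + t :=
    hst.trans (add_le_add_right (mul_le_mul_right
      (ENNReal.rpow_le_rpow hD (by norm_num : (0 : ℝ) ≤ 1 / 2)) _) _)
  have h2 : t + t ≤ A ^ (1 / 2 : ℝ) := by
    rw [← ENNReal.rpow_le_rpow_iff (z := (2 : ℝ)) (by norm_num), hsq, ← two_mul,
      ENNReal.mul_rpow_of_nonneg _ _ (by norm_num : (0 : ℝ) ≤ 2), ht2, ENNReal.rpow_two]
    calc (2 : ℝ≥0∞) ^ 2 * (a * N) = 4 * (a * N) := by norm_num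
      _ ≤ A := hA
  have h3 : t ≤ B ^ (1 / 2 : ℝ) := (ENNReal.add_le_add_iff_right ht).1 (h2.trans h1)
  calc a * N = t ^ (2 : ℝ) := ht2.symm
    _ ≤ (B ^ (1 / 2 : ℝ)) ^ (2 : ℝ) := ENNReal.rpow_le_rpow h3 (by norm_num)
    _ = B := hsq B

end PositivityTransfer

/-- **`PositivityTransfer`** (closes stmt-AtomisticToContinuum-12846, exact route signature):
`GroundStateEnergyFinite → GroundStateRigidity → PositiveNearMinimiserExists → OccupationStability →
PositiveZeroMode → X_B1` — flat-mode occupation `≥ (c/4)·N` for ALL `δ`-near-minimisers of the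
Dirichlet energy in the box of side `(N/ρ)^{1/3}` at small density, from the bound `≥ c·N` for the
non-negative ones: phase rigidity puts every near-minimiser `η = c/4`-close (up to a unit phase) to a
positive near-minimiser, and `√occ` is `√N‖·‖₂`-Lipschitz (`OccupationStability`).
[cite: LSSY2005, §1.2 (1.17)–(1.19)] -/
theorem positivityTransfer_proof :
    Summit.AtomisticToContinuum.BoseEinsteinCondensation.Theses.BECRieszReverseHolder.PositivityTransfer := by
  intro hfin hrig hpos hstab hpzm v hv
  obtain ⟨ρ₁, hρ₁, H1⟩ := hfin v hv
  obtain ⟨ρ₂, hρ₂, H2⟩ := hrig v hv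
  obtain ⟨ρ₃, hρ₃, H3⟩ := hpzm v hv
  refine ⟨min ρ₁ (min ρ₂ ρ₃), lt_min hρ₁ (lt_min hρ₂ hρ₃), fun ρ hρ hρlt => ?_⟩
  have hρ1 : ρ < ρ₁ := hρlt.trans_le (min_le_left _ _)
  have hρ2 : ρ < ρ₂ := (hρlt.trans_le (min_le_right _ _)).trans_le (min_le_left _ _)
  have hρ3 : ρ < ρ₃ := (hρlt.trans_le (min_le_right _ _)).trans_le (min_le_right _ _)
  obtain ⟨c, hc, H3'⟩ := H3 ρ hρ hρ3
  refine ⟨c / 4, by positivity, ?_⟩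
  filter_upwards [H1 ρ hρ hρ1, H2 ρ hρ hρ2, H3', eventually_ge_atTop 1] with N hE hR hP hN1
  -- `N = n + 1` (the stability item is stated for `n + 1` particles)
  obtain ⟨n, rfl⟩ : ∃ n, N = n + 1 := ⟨N - 1, by omega⟩
  have hL : 0 < sideLength ρ (n + 1) := by
    unfold sideLength
    exact Real.rpow_pos_of_pos (div_pos (Nat.cast_pos.mpr n.succ_pos) hρ) _
  -- `η := c / 4`, `δ := min δ_rig δ_pos`
  obtain ⟨δr, hδr, HR⟩ := hR (c / 4) (by positivity)
  obtain ⟨δp, hδp, HP⟩ := hP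
  refine ⟨min δr δp, lt_min hδr hδp, fun Ψ hΨ => ?_⟩
  -- a positive `δ`-near-minimiser `Φ` (exists since `E₀ ≠ ⊤`)
  obtain ⟨Φ, hΦE, hΦpos⟩ := hpos v (n + 1) _ hE (min δr δp) (lt_min hδr hδp)
  -- rigidity for the pair `(Φ, Ψ)`: `∫ |Φ - c₁ Ψ|² ≤ c / 4`
  obtain ⟨c₁, hc₁, hclose⟩ := HR Φ Ψ (hΦE.trans (add_le_add_right (min_le_left _ _) _))
    (hΨ.trans (add_le_add_right (min_le_left _ _) _))
  -- positivity: `ofReal (c N) ≤ occ Φ`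
  have hoccΦ := HP Φ (hΦE.trans (add_le_add_right (min_le_right _ _) _)) hΦpos
  -- stability for the normalised measurable flat mode
  have hst := hstab n _ _ (_root_.AtomisticToContinuum.BECInfraredBound.aestronglyMeasurable_constMode _)
    (_root_.AtomisticToContinuum.BECInfraredBound.lintegral_constMode_sq hL) Φ Ψ c₁ hc₁
  -- `ℝ≥0∞` bookkeeping
  have h4 : ENNReal.ofReal (c * ((n + 1 : ℕ) : ℝ)) =
      4 * (ENNReal.ofReal (c / 4) * ((n + 1 : ℕ) : ℝ≥0∞)) := by
    have : c * ((n + 1 : ℕ) : ℝ) = 4 * (c / 4 * ((n + 1 : ℕ) : ℝ)) := by ring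
    rw [this, ENNReal.ofReal_mul (by norm_num : (0 : ℝ) ≤ 4),
      ENNReal.ofReal_mul (by positivity : (0 : ℝ) ≤ c / 4), ENNReal.ofReal_ofNat,
      ENNReal.ofReal_natCast]
  rw [h4] at hoccΦ
  have key := PositivityTransfer.mul_le_of_sqrt_le (ENNReal.natCast_ne_top _) ENNReal.ofReal_ne_top
    hoccΦ hst hclose
  rwa [← ENNReal.ofReal_natCast, ← ENNReal.ofReal_mul (by positivity : (0 : ℝ) ≤ c / 4)] at key

end Summit.AtomisticToContinuum.BoseEinsteinCondensation.Theorems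

end
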